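/-
Copyright (c) 2026. All rights reserved.
Released under Apache 2.0 license as described in the file LICENSE.
Authors: abc-iut cell, prover seat abc-iut-w5-d039 (wave 5, gen 7).
-/
import Literature.IUT.LogVolume.UnitLogBallVolumeCriterion
import Literature.IUT.LogVolume.LogShellTopology
import HarnessLib

/-!
# `p`-power multiples of `log_p(𝒪_K^×)` among the balls: ALL or NONE, and exactly when `log_p(𝒪_K^×) ⊆ 𝔪^{1+m/f}`

Proof-only companion (theorems, no definitions) of `UnitLogBallVolumeCriterion.lean` (this seat: the volume
constraint `{‖y‖ ≤ ‖ϖ‖^j} = p^k · log_p(𝒪_K^×) ⇒ m = f·(j − k·e − 1)`) — the STRUCTURAL form of the whole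
«which balls are `p^k · log_p(𝒪_K^×)`» question of the abc-iut cell's TEAM R ball-mover thread (abc-iut-w5-d216 /
w5-d180 / w5-d039 / w6-d060 / w4-d017 / w5-d014), valid at every `p`, `e`, `f`, tame or wild:

* `closedBall_zpow_eq_zpow_smul_logUnits_iff_logUnits_eq`: `{‖y‖ ≤ ‖ϖ‖^j} = p^k · log_p(𝒪_K^×)` iff
  `log_p(𝒪_K^×)` IS the ball `{‖y‖ ≤ ‖ϖ‖^{j − k·e}}` (descaling);
* `logUnits_eq_closedBall_zpow_iff`: `log_p(𝒪_K^×) = {‖y‖ ≤ ‖ϖ‖^N}` iff **`f·N = f + m` AND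
  `log_p(𝒪_K^×) ⊆ {‖y‖ ≤ ‖ϖ‖^N}`** — (⇒) by the volume `μ(log_p 𝒪^×) = p^{−(f+m)}` ([IUTchIV] Prop. 1.4 (ii),
  abc-iut-S8), (⇐) because a compact open subgroup contained in a ball OF THE SAME Haar measure is that ball
  (the difference is an open null set);
* hence **`exists_closedBall_zpow_eq_zpow_smul_logUnits_iff`**: the ball `{‖y‖ ≤ ‖ϖ‖^j}` is a
  `p^k · log_p(𝒪_K^×)` for some `k` iff `∃ N, f·N = f + m ∧ log_p(𝒪_K^×) ⊆ 𝔪^N ∧ e ∣ j − N`; in words: EITHER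
  `f ∣ m` and every unit logarithm has norm `≤ ‖ϖ‖^{1 + m/f}` — then exactly the balls `𝔪^j`,
  `j ≡ 1 + m/f (mod e)`, are `p`-power multiples of `log_p(𝒪_K^×)` — OR no ball at all is
  (`forall_closedBall_ne_zpow_smul_logUnits_of_exists_norm_gt`: one unit logarithm of norm `> ‖ϖ‖^N` for the
  forced `N` kills every ball; `…_of_not_dvd`: `f ∤ m` kills every ball).

This recovers in one statement: abc-iut-w5-d180's tame criterion (`m = 0`, `log ⊆ 𝔪`: `e ∣ j − 1`),
abc-iut-w6-d060's odd classification (`ζ_p`, `f = 1`: `m = 1`, `N = 2`: `e ∣ j − 2`; `f ≥ 2` with `ζ_p`: `f ∤ 1`,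
none), abc-iut-w4-d017/w5-d014's dyadic cells (`ℚ_2`: `N = 2`; `ℚ_2(√3)`-shape: `N = 2`; `ℚ_2(√−1)`-shape:
`N = 3`), and this seat's census.  By abc-iut-w5-d180's criterion (`Thm311RealIsmDHMoverCriterion`) these are
exactly the balls fixed by every element of Dupuy–Hilado's (Ind2) group; the consumer
`Summits/ABC/IUTFork/Thm311RealIsmDHMoverFixedCriterion.lean` says so.  Classical local analysis (Neukirch,
*Algebraic Number Theory*, Ch. II (5.5), (5.7); Weil, *Basic Number Theory*, Ch. I §4 for Haar measure);
nothing here bears on the disputed [IUTchIII] Cor. 3.12. [cite: NeukirchANT1999, Ch. II (5.5), (5.7)]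
[cite: WeilBNT1967, Ch. II §2, Th. 1–2]
-/

noncomputable section

open MeasureTheory Set Metric
open scoped Pointwise ENNReal
open Literature.NumberTheory.GaloisRepresentations.Ultrametric

namespace Literature.IUT.LogVolume

variable (p : ℕ) [Fact p.Prime]
variable (K : Type*) [NontriviallyNormedField K] [instK : NormedAlgebra ℚ_[p] K] [IsUltrametricDist K]
  [ProperSpace K]

/-! ## 1. Descaling -/

/-- **`{‖y‖ ≤ ‖ϖ‖^j} = p^k · log_p(𝒪_K^×)` iff `log_p(𝒪_K^×) = {‖y‖ ≤ ‖ϖ‖^{j − k·e}}`** (`‖p‖ = ‖ϖ‖^e`).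
[cite: NeukirchANT1999, Ch. II (5.5)] -/
theorem closedBall_zpow_eq_zpow_smul_logUnits_iff_logUnits_eq {ϖ : Kˣ} (hϖ : IsUniformizer ϖ) (j k : ℤ) :
    closedBall (0 : K) (‖(ϖ : K)‖ ^ j) = ((p : ℚ_[p]) ^ k) • logUnits K ↔
      logUnits K = closedBall (0 : K) (‖(ϖ : K)‖ ^ (j - k * absRamificationIdx p K)) := by
  have hϖ0 : ‖(ϖ : K)‖ ≠ 0 := norm_ne_zero_iff.2 ϖ.ne_zero
  have hrad : (p : ℝ) ^ k * ‖(ϖ : K)‖ ^ j = ‖(ϖ : K)‖ ^ (j - k * absRamificationIdx p K) := by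
    rw [zpow_sub₀ hϖ0, mul_comm k, zpow_mul, zpow_natCast, norm_pow_absRamificationIdx p K hϖ, inv_zpow',
      zpow_neg, div_inv_eq_mul, mul_comm]
  rw [closedBall_eq_zpow_smul_iff p K, hrad]

/-! ## 2. When is `log_p(𝒪_K^×)` itself a ball? -/

/-- Volumes in `ℝ`: `μ_K({‖y‖ ≤ ‖ϖ‖^N}) = p^{−f·N}`. [cite: WeilBNT1967, Ch. I §4, Th. 6] -/
theorem localVolume_real_closedBall_zpow_eq_prime_zpow [MeasurableSpace K] [BorelSpace K] {ϖ : Kˣ}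
    (hϖ : IsUniformizer ϖ) (N : ℤ) :
    (localVolume K (closedBall (0 : K) (‖(ϖ : K)‖ ^ N))).toReal = (p : ℝ) ^ (-((residueDegree p K : ℤ) * N)) := by
  rw [localVolume_real_closedBall_zpow K hϖ N, residueCard_eq_pow p K]
  push_cast
  rw [← zpow_natCast, ← zpow_mul, mul_neg]

/-- **`log_p(𝒪_K^×) = {‖y‖ ≤ ‖ϖ‖^N}` forces `f·N = f + m`** (compare `μ_K = p^{−fN}` with `p^{−(f+m)}`).
[cite: NeukirchANT1999, Ch. II (5.7)] -/
theorem mul_eq_of_logUnits_eq_closedBall_zpow {ϖ : Kˣ} (hϖ : IsUniformizer ϖ) {N : ℤ}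
    (h : logUnits K = closedBall (0 : K) (‖(ϖ : K)‖ ^ N)) :
    (residueDegree p K : ℤ) * N = residueDegree p K + torsionPExp p K := by
  borelize K
  have hp : p.Prime := Fact.out
  have hp0 : (0 : ℝ) < p := by exact_mod_cast hp.pos
  have hp1 : (p : ℝ) ≠ 1 := by exact_mod_cast hp.one_lt.ne'
  have hvol := localVolume_real_logUnits_eq_inv_pow p K
  rw [h, localVolume_real_closedBall_zpow_eq_prime_zpow p K hϖ N, ← zpow_natCast, ← zpow_neg] at hvol
  have hexp := zpow_right_injective₀ hp0 hp1 hvol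
  push_cast at hexp
  linarith

/-- **A compact open set inside a ball of the same Haar measure IS the ball** (the difference is an open null
set). [cite: WeilBNT1967, Ch. I §4, Th. 6] -/
theorem eq_closedBall_of_subset_of_localVolume_eq [MeasurableSpace K] [BorelSpace K] {A : Set K} (hA : IsCompact A)
    {r : ℝ} (hr : r ≠ 0) (hsub : A ⊆ closedBall (0 : K) r)
    (hvol : localVolume K A = localVolume K (closedBall (0 : K) r)) : A = closedBall (0 : K) r := by
  refine hsub.antisymm ?_
  have hBopen : IsOpen (closedBall (0 : K) r) := IsUltrametricDist.isOpen_closedBall _ hr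
  have hAclosed : IsClosed A := hA.isClosed
  have hdiff_open : IsOpen (closedBall (0 : K) r \ A) := hBopen.sdiff hAclosed
  have hAfin : localVolume K A ≠ ∞ := hA.measure_lt_top.ne
  have hdiff : localVolume K (closedBall (0 : K) r \ A) = 0 := by
    rw [measure_sdiff hsub hAclosed.measurableSet.nullMeasurableSet hAfin, hvol, tsub_self]
  have hempty : closedBall (0 : K) r \ A = ∅ := (hdiff_open.measure_eq_zero_iff (localVolume K)).mp hdiff
  intro x hx
  by_contra hxA
  have : x ∈ closedBall (0 : K) r \ A := ⟨hx, hxA⟩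
  rw [hempty] at this
  exact this

/-- **`log_p(𝒪_K^×) = {‖y‖ ≤ ‖ϖ‖^N}` iff `f·N = f + m` and `log_p(𝒪_K^×) ⊆ {‖y‖ ≤ ‖ϖ‖^N}`** — i.e. iff
`f ∣ m`, `N = 1 + m/f`, and every unit logarithm has norm `≤ ‖ϖ‖^N`. (⇒) volume; (⇐) `log_p(𝒪_K^×)` is compact
open of Haar measure `p^{−(f+m)} = p^{−fN} = μ(𝔪^N)`. [cite: NeukirchANT1999, Ch. II (5.5), (5.7)] -/
theorem logUnits_eq_closedBall_zpow_iff {ϖ : Kˣ} (hϖ : IsUniformizer ϖ) (N : ℤ) :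
    logUnits K = closedBall (0 : K) (‖(ϖ : K)‖ ^ N) ↔
      (residueDegree p K : ℤ) * N = residueDegree p K + torsionPExp p K ∧
        logUnits K ⊆ closedBall (0 : K) (‖(ϖ : K)‖ ^ N) := by
  constructor
  · intro h
    exact ⟨mul_eq_of_logUnits_eq_closedBall_zpow p K hϖ h, h.le⟩
  · rintro ⟨hN, hsub⟩
    borelize K
    have hp : p.Prime := Fact.out
    have hr : ‖(ϖ : K)‖ ^ N ≠ 0 := zpow_ne_zero _ (norm_ne_zero_iff.2 ϖ.ne_zero)
    refine eq_closedBall_of_subset_of_localVolume_eq K (isCompact_logUnits p K) hr hsub ?_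
    -- both volumes are `p^{-(f+m)}`
    have hΛfin : localVolume K (logUnits K) ≠ ∞ := (isCompact_logUnits p K).measure_lt_top.ne
    have hBfin : localVolume K (closedBall (0 : K) (‖(ϖ : K)‖ ^ N)) ≠ ∞ :=
      (isCompact_closedBall (0 : K) _).measure_lt_top.ne
    rw [← ENNReal.toReal_eq_toReal_iff' hΛfin hBfin, localVolume_real_logUnits_eq_inv_pow p K,
      localVolume_real_closedBall_zpow_eq_prime_zpow p K hϖ N, ← zpow_natCast]
    push_cast
    rw [← hN, zpow_neg]

/-! ## 3. The balls that are `p^k · log_p(𝒪_K^×)`: all of one residue class mod `e`, or none -/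

/-- **STRUCTURAL CRITERION**: the ball `{‖y‖ ≤ ‖ϖ‖^j}` equals `p^k · log_p(𝒪_K^×)` for some `k ∈ ℤ` iff there is
`N ∈ ℤ` with `f·N = f + m`, `log_p(𝒪_K^×) ⊆ {‖y‖ ≤ ‖ϖ‖^N}` and `e ∣ j − N`.  So: if `f ∣ m` and every unit
logarithm has norm `≤ ‖ϖ‖^{1+m/f}`, exactly the balls `𝔪^j` with `j ≡ 1 + m/f (mod e)` qualify; otherwise none.
[cite: NeukirchANT1999, Ch. II (5.5), (5.7)] [cite: WeilBNT1967, Ch. II §2, Th. 1–2] -/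
theorem exists_closedBall_zpow_eq_zpow_smul_logUnits_iff {ϖ : Kˣ} (hϖ : IsUniformizer ϖ) (j : ℤ) :
    (∃ k : ℤ, closedBall (0 : K) (‖(ϖ : K)‖ ^ j) = ((p : ℚ_[p]) ^ k) • logUnits K) ↔
      ∃ N : ℤ, (residueDegree p K : ℤ) * N = residueDegree p K + torsionPExp p K ∧
        logUnits K ⊆ closedBall (0 : K) (‖(ϖ : K)‖ ^ N) ∧ ((absRamificationIdx p K : ℕ) : ℤ) ∣ j - N := by
  constructor
  · rintro ⟨k, hk⟩
    rw [closedBall_zpow_eq_zpow_smul_logUnits_iff_logUnits_eq p K hϖ] at hk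
    obtain ⟨hN, hsub⟩ := (logUnits_eq_closedBall_zpow_iff p K hϖ _).1 hk
    exact ⟨j - k * absRamificationIdx p K, hN, hsub, ⟨k, by ring⟩⟩
  · rintro ⟨N, hN, hsub, ⟨k, hk⟩⟩
    refine ⟨k, ?_⟩
    rw [closedBall_zpow_eq_zpow_smul_logUnits_iff_logUnits_eq p K hϖ]
    have hjN : j - k * absRamificationIdx p K = N := by linarith
    rw [hjN]
    exact (logUnits_eq_closedBall_zpow_iff p K hϖ N).2 ⟨hN, hsub⟩

/-- The forced exponent is unique: `f·N = f + m` pins `N`. [cite: NeukirchANT1999, Ch. II (5.7)] -/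
theorem eq_of_residueDegree_mul_eq {N N' : ℤ} (hN : (residueDegree p K : ℤ) * N = residueDegree p K + torsionPExp p K)
    (hN' : (residueDegree p K : ℤ) * N' = residueDegree p K + torsionPExp p K) : N = N' := by
  have hf : (0 : ℤ) < residueDegree p K := by exact_mod_cast residueDegree_pos p K
  have h : (residueDegree p K : ℤ) * (N - N') = 0 := by rw [mul_sub]; linarith
  rcases mul_eq_zero.mp h with h | h
  · exact absurd h hf.ne'
  · linarith

/-- **ALL OR NONE**: if ONE ball `{‖y‖ ≤ ‖ϖ‖^{j₀}}` is a `p^{k₀} · log_p(𝒪_K^×)`, then `{‖y‖ ≤ ‖ϖ‖^j}` is a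
`p^k · log_p(𝒪_K^×)` for some `k` iff `e ∣ j − j₀`. [cite: NeukirchANT1999, Ch. II (5.5), (5.7)]
[cite: WeilBNT1967, Ch. II §2, Th. 2] -/
theorem exists_closedBall_zpow_eq_zpow_smul_logUnits_iff_dvd_sub {ϖ : Kˣ} (hϖ : IsUniformizer ϖ) {j₀ k₀ : ℤ}
    (h₀ : closedBall (0 : K) (‖(ϖ : K)‖ ^ j₀) = ((p : ℚ_[p]) ^ k₀) • logUnits K) (j : ℤ) :
    (∃ k : ℤ, closedBall (0 : K) (‖(ϖ : K)‖ ^ j) = ((p : ℚ_[p]) ^ k) • logUnits K) ↔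
      ((absRamificationIdx p K : ℕ) : ℤ) ∣ j - j₀ := by
  obtain ⟨N₀, hN₀, hsub₀, hdvd₀⟩ := (exists_closedBall_zpow_eq_zpow_smul_logUnits_iff p K hϖ j₀).1 ⟨k₀, h₀⟩
  rw [exists_closedBall_zpow_eq_zpow_smul_logUnits_iff p K hϖ j]
  constructor
  · rintro ⟨N, hN, -, hdvd⟩
    have hNN : N = N₀ := eq_of_residueDegree_mul_eq p K hN hN₀
    rw [hNN] at hdvd
    have := dvd_sub hdvd hdvd₀
    rwa [sub_sub_sub_cancel_right] at this
  · intro hdvd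
    refine ⟨N₀, hN₀, hsub₀, ?_⟩
    have := dvd_add hdvd hdvd₀
    rwa [sub_add_sub_cancel] at this

/-- **NONE, by one large unit logarithm**: if `f·N = f + m` and some `z ∈ log_p(𝒪_K^×)` has `‖z‖ > ‖ϖ‖^N`, then
NO ball is a `p^k · log_p(𝒪_K^×)`. [cite: NeukirchANT1999, Ch. II (5.5), (5.7)] -/
theorem forall_closedBall_ne_zpow_smul_logUnits_of_exists_norm_gt {ϖ : Kˣ} (hϖ : IsUniformizer ϖ) {N : ℤ}
    (hN : (residueDegree p K : ℤ) * N = residueDegree p K + torsionPExp p K)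
    (hz : ∃ z ∈ logUnits K, ‖(ϖ : K)‖ ^ N < ‖z‖) (j k : ℤ) :
    closedBall (0 : K) (‖(ϖ : K)‖ ^ j) ≠ ((p : ℚ_[p]) ^ k) • logUnits K := by
  intro h
  obtain ⟨N', hN', hsub, -⟩ := (exists_closedBall_zpow_eq_zpow_smul_logUnits_iff p K hϖ j).1 ⟨k, h⟩
  have hNN : N' = N := eq_of_residueDegree_mul_eq p K hN' hN
  obtain ⟨z, hz, hlt⟩ := hz
  have hle := hsub hz
  rw [mem_closedBall_zero_iff, hNN] at hle
  exact hle.not_gt hlt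

/-- **NONE, when `f ∤ m`**: then no ball at all is a `p^k · log_p(𝒪_K^×)` (e.g. `ζ_p ∈ K` with `p` odd and `f ≥ 2`
at `m = 1`). [cite: NeukirchANT1999, Ch. II (5.7)] -/
theorem forall_closedBall_ne_zpow_smul_logUnits_of_not_dvd (hf : ¬ residueDegree p K ∣ torsionPExp p K)
    {ϖ : Kˣ} (hϖ : IsUniformizer ϖ) (j k : ℤ) :
    closedBall (0 : K) (‖(ϖ : K)‖ ^ j) ≠ ((p : ℚ_[p]) ^ k) • logUnits K := by
  intro h
  obtain ⟨N, hN, -, -⟩ := (exists_closedBall_zpow_eq_zpow_smul_logUnits_iff p K hϖ j).1 ⟨k, h⟩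
  apply hf
  have hdvd : ((residueDegree p K : ℕ) : ℤ) ∣ (torsionPExp p K : ℤ) := ⟨N - 1, by linarith⟩
  exact_mod_cast hdvd

/-- **ALL, from a containment**: if `f·N = f + m` and `log_p(𝒪_K^×) ⊆ {‖y‖ ≤ ‖ϖ‖^N}`, then `log_p(𝒪_K^×) = 𝔪^N` and
the ball `𝔪^j` is a `p^k · log_p(𝒪_K^×)` iff `e ∣ j − N` (e.g. abc-iut-w5-d172's `e ≤ p − 1 ⇒ log ⊆ 𝔪` at `m = 0`
gives w5-d180's tame criterion `e ∣ j − 1`, now up to `e = p − 1` without `ζ_p`).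
[cite: NeukirchANT1999, Ch. II (5.5), (5.7)] -/
theorem exists_closedBall_zpow_eq_zpow_smul_logUnits_iff_dvd_of_subset {ϖ : Kˣ} (hϖ : IsUniformizer ϖ) {N : ℤ}
    (hN : (residueDegree p K : ℤ) * N = residueDegree p K + torsionPExp p K)
    (hsub : logUnits K ⊆ closedBall (0 : K) (‖(ϖ : K)‖ ^ N)) (j : ℤ) :
    (∃ k : ℤ, closedBall (0 : K) (‖(ϖ : K)‖ ^ j) = ((p : ℚ_[p]) ^ k) • logUnits K) ↔
      ((absRamificationIdx p K : ℕ) : ℤ) ∣ j - N := by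
  rw [exists_closedBall_zpow_eq_zpow_smul_logUnits_iff p K hϖ j]
  constructor
  · rintro ⟨N', hN', -, hdvd⟩
    rwa [eq_of_residueDegree_mul_eq p K hN' hN] at hdvd
  · intro hdvd
    exact ⟨N, hN, hsub, hdvd⟩

end Literature.IUT.LogVolume

end
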